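import Mathlib
import Literature.NumberTheory.EllipticCurves.ModularCurveKleinJ
import Literature.NumberTheory.EllipticCurves.KleinJIntegralQExpansion
import Literature.NumberTheory.EllipticCurves.ModularPolynomial
import Literature.NumberTheory.Automorphic.GaloisConjugateGroup

/-!
# Monodromy of a holomorphic function algebraic over `ℂ(j)` (stub `stub_monodromy`)

Crux item stmt-Langlands-8457, route `CapacityClassicality`, line `Sketch`, stub `stub_monodromy`.

Let `y : ℍ → ℂ` be holomorphic and `1`-periodic and suppose `Σ c_{ij} j(τ)ⁱ y(τ)ʲ = 0` on `ℍ` for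
a nonzero coefficient array `c`, `j = kleinJ` Klein's invariant. Then `y` is invariant under a
finite-index subgroup `Γ' ∋ T` of `SL(2, ℤ)` and all translates `y ∘ γ`, `γ ∈ SL(2, ℤ)`, are
`O(e^{A Im τ})` at `i∞`, uniformly in `γ`.

Proof. Write the relation as `Σ_j Q_j(j(τ)) y(τ)ʲ = 0` with `Q_j = Σ_i c_{ij} Xⁱ ∈ ℂ[X]`. The set
`𝓡` of holomorphic solutions `z` of this relation is finite: if `z₀, …, z_n` are distinct solutions
(`n + 1` the number of `j`'s), pick `τ₀` off the zero sets of `Q_{j₀} ∘ j` (`Q_{j₀} ≠ 0`, `j`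
transcendental) and of the `z_a − z_b` (identity theorem on `ℍ`); then the `z_a(τ₀)` are `n + 1`
distinct roots of a nonzero polynomial of degree `≤ n`. `SL(2, ℤ)` permutes `𝓡` (`j ∘ γ = j`), so
the stabiliser `Γ'` of `y` has finite index; `T ∈ Γ'` by periodicity. Growth: Cauchy's root bound
for the top nonvanishing `Q_e`, `|Q_j(j(τ))| ≪ |j(τ)|^{D} ≪ e^{2πD Im τ}` (`q j → 1`) and
`|Q_e(j(τ))| ≥ m > 0` near `i∞` (`|j(τ)| → ∞`).
-/

set_option linter.dupNamespace false -- project-wide option (lakefile weak.linter.dupNamespace); `Summit.Langlands.Langlands` is the mandated namespace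

open scoped MatrixGroups Manifold Topology
open UpperHalfPlane CongruenceSubgroup Metric PowerSeries
open Literature.NumberTheory.Automorphic
open Literature.NumberTheory.EllipticCurves Literature.NumberTheory.EllipticCurves.ModularForms

noncomputable section

namespace Summit.Langlands.Langlands.Theorems.CapacityClassicality

/-! ## Polynomials with `Fin`-indexed coefficients -/

/-- Evaluation of `∑ⱼ C (b j) X ^ j`. -/
private theorem eval_sum_C_mul_X_pow {n : ℕ} (b : Fin (n + 1) → ℂ) (w : ℂ) :
    (∑ j : Fin (n + 1), Polynomial.C (b j) * Polynomial.X ^ (j : ℕ)).eval w =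
      ∑ j : Fin (n + 1), b j * w ^ (j : ℕ) := by
  simp [Polynomial.eval_finsetSum]

/-- Coefficients of `∑ⱼ C (b j) X ^ j`. -/
private theorem coeff_sum_C_mul_X_pow {n : ℕ} (b : Fin (n + 1) → ℂ) (k : Fin (n + 1)) :
    (∑ j : Fin (n + 1), Polynomial.C (b j) * Polynomial.X ^ (j : ℕ)).coeff k = b k := by
  simp [Polynomial.finsetSum_coeff, Fin.val_inj]

/-- `∑ⱼ C (b j) X ^ j ≠ 0` as soon as one coefficient `b k ≠ 0`. -/
private theorem sum_C_mul_X_pow_ne_zero {n : ℕ} {b : Fin (n + 1) → ℂ} {k : Fin (n + 1)}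
    (hk : b k ≠ 0) :
    (∑ j : Fin (n + 1), Polynomial.C (b j) * Polynomial.X ^ (j : ℕ)) ≠ 0 := fun h ↦
  hk (by rw [← coeff_sum_C_mul_X_pow b k, h, Polynomial.coeff_zero])

/-- `natDegree (∑ⱼ C (b j) X ^ j) ≤ n` for `j` ranging over `Fin (n + 1)`. -/
private theorem natDegree_sum_C_mul_X_pow_le {n : ℕ} (b : Fin (n + 1) → ℂ) :
    (∑ j : Fin (n + 1), Polynomial.C (b j) * Polynomial.X ^ (j : ℕ)).natDegree ≤ n :=
  Polynomial.natDegree_sum_le_of_forall_le _ _ fun j _ ↦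
    (Polynomial.natDegree_C_mul_X_pow_le (b j) j).trans (Nat.lt_succ_iff.mp j.isLt)

/-- **Cauchy-type root bound.** If `∑ⱼ b j w ^ j = 0`, the coefficients vanish above the index
`e` and `b e ≠ 0`, then `‖w‖ ≤ max 1 ((∑ⱼ ‖b j‖) / ‖b e‖)`. -/
private theorem norm_root_le {n : ℕ} (b : Fin (n + 1) → ℂ) (e : Fin (n + 1)) (he : b e ≠ 0)
    (hvan : ∀ j, e < j → b j = 0) {w : ℂ} (hw : ∑ j : Fin (n + 1), b j * w ^ (j : ℕ) = 0) :
    ‖w‖ ≤ max 1 ((∑ j : Fin (n + 1), ‖b j‖) / ‖b e‖) := by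
  rcases le_or_gt ‖w‖ 1 with h1 | h1
  · exact le_max_of_le_left h1
  refine le_max_of_le_right ?_
  have hbe : 0 < ‖b e‖ := norm_pos_iff.mpr he
  rw [le_div_iff₀ hbe]
  -- isolate the top term
  have hsplit : b e * w ^ (e : ℕ) = -∑ j ∈ Finset.univ.erase e, b j * w ^ (j : ℕ) := by
    rw [← Finset.add_sum_erase _ _ (Finset.mem_univ e)] at hw
    linear_combination hw
  rcases Nat.eq_zero_or_pos (e : ℕ) with he0 | he0
  · -- `e = 0`: all the other coefficients vanish, so `b e = 0`, absurd
    exfalso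
    have hzero : ∑ j ∈ Finset.univ.erase e, b j * w ^ (j : ℕ) = 0 := by
      refine Finset.sum_eq_zero fun j hj ↦ ?_
      have hne : j ≠ e := Finset.ne_of_mem_erase hj
      have hlt : e < j := by
        rw [Fin.lt_def, he0]
        exact Nat.pos_of_ne_zero fun h ↦ hne (Fin.ext (by omega))
      rw [hvan j hlt, zero_mul]
    rw [hzero, neg_zero, he0, pow_zero, mul_one] at hsplit
    exact he hsplit
  · have hbound : ∀ j ∈ Finset.univ.erase e,
        ‖b j * w ^ (j : ℕ)‖ ≤ ‖b j‖ * ‖w‖ ^ ((e : ℕ) - 1) := by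
      intro j hj
      have hne : j ≠ e := Finset.ne_of_mem_erase hj
      rcases lt_or_gt_of_ne hne with hlt | hgt
      · rw [norm_mul, norm_pow]
        have hjle : (j : ℕ) ≤ (e : ℕ) - 1 := by
          have := Fin.lt_def.mp hlt
          omega
        exact mul_le_mul_of_nonneg_left (pow_le_pow_right₀ h1.le hjle) (norm_nonneg _)
      · rw [hvan j hgt, zero_mul, norm_zero]
        positivity
    have key : ‖b e‖ * ‖w‖ ^ (e : ℕ) ≤ (∑ j, ‖b j‖) * ‖w‖ ^ ((e : ℕ) - 1) := by
      calc ‖b e‖ * ‖w‖ ^ (e : ℕ) = ‖b e * w ^ (e : ℕ)‖ := by rw [norm_mul, norm_pow]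
        _ = ‖∑ j ∈ Finset.univ.erase e, b j * w ^ (j : ℕ)‖ := by rw [hsplit, norm_neg]
        _ ≤ ∑ j ∈ Finset.univ.erase e, ‖b j‖ * ‖w‖ ^ ((e : ℕ) - 1) :=
          norm_sum_le_of_le (Finset.univ.erase e) hbound
        _ = (∑ j ∈ Finset.univ.erase e, ‖b j‖) * ‖w‖ ^ ((e : ℕ) - 1) :=
          (Finset.sum_mul _ _ _).symm
        _ ≤ (∑ j, ‖b j‖) * ‖w‖ ^ ((e : ℕ) - 1) :=
          mul_le_mul_of_nonneg_right
            (Finset.sum_le_sum_of_subset_of_nonneg (Finset.erase_subset _ _)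
              fun i _ _ ↦ norm_nonneg (b i))
            (pow_nonneg (norm_nonneg w) _)
    have hwpos : 0 < ‖w‖ ^ ((e : ℕ) - 1) := pow_pos (by linarith) _
    have hpow : ‖w‖ ^ (e : ℕ) = ‖w‖ * ‖w‖ ^ ((e : ℕ) - 1) := by
      rw [← pow_succ']
      congr 1
      omega
    rw [hpow, ← mul_assoc] at key
    rw [mul_comm]
    exact le_of_mul_le_mul_right key hwpos

/-! ## Holomorphic roots of a polynomial relation over `ℂ[j]` -/

/-- A holomorphic function on `ℍ` that is not identically zero is nonzero on a punctured
neighbourhood of every point (identity theorem). -/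
private theorem eventually_ne_zero {h : ℍ → ℂ} (hh : MDiff h) (h0 : h ≠ 0) (τ : ℍ) :
    ∀ᶠ z in 𝓝[≠] τ, h z ≠ 0 :=
  Filter.not_frequently.mp fun hfr ↦ h0 (UpperHalfPlane.eq_zero_of_frequently hh hfr)

/-- `τ ↦ P(j(τ))` is holomorphic on `ℍ`. -/
private theorem mdifferentiable_eval_kleinJ (P : Polynomial ℂ) :
    MDiff fun τ : ℍ ↦ P.eval (kleinJ τ) :=
  UpperHalfPlane.mdifferentiable_iff.mpr
    (P.differentiable.comp_differentiableOn differentiableOn_kleinJ)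

/-- **At most `n` holomorphic roots.** If `Q : Fin (n + 1) → ℂ[X]` has a nonzero entry, any finite
set of holomorphic functions `z` on `ℍ` with `Σⱼ Q_j(j(τ)) z(τ)ʲ = 0` has at most `n` elements:
at a point `τ₀` where `Q_{j₀}(j(τ₀)) ≠ 0` and where the members take pairwise distinct values,
these values are distinct roots of a nonzero polynomial of degree `≤ n`. -/
private theorem card_le_of_roots {n : ℕ} (Q : Fin (n + 1) → Polynomial ℂ) (j₀ : Fin (n + 1))
    (hQ : Q j₀ ≠ 0) (s : Finset (ℍ → ℂ))
    (hs : ∀ z ∈ s, MDiff z ∧ ∀ τ : ℍ, ∑ j, (Q j).eval (kleinJ τ) * z τ ^ (j : ℕ) = 0) :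
    s.card ≤ n := by
  classical
  -- a point where `Q j₀ ∘ kleinJ ≠ 0` and the elements of `s` take distinct values
  have h1 : ∀ᶠ τ in 𝓝[≠] UpperHalfPlane.I, (Q j₀).eval (kleinJ τ) ≠ 0 :=
    eventually_ne_zero (mdifferentiable_eval_kleinJ (Q j₀)) (kleinJ_aeval_ne_zero hQ) _
  have h2 : ∀ᶠ τ in 𝓝[≠] UpperHalfPlane.I, ∀ p ∈ s.offDiag, (p.1 - p.2) τ ≠ 0 := by
    refine (Filter.eventually_all_finset _).mpr fun p hp ↦ ?_
    obtain ⟨hp1, hp2, hne⟩ := Finset.mem_offDiag.mp hp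
    exact eventually_ne_zero ((hs _ hp1).1.sub (hs _ hp2).1) (sub_ne_zero.mpr hne) _
  obtain ⟨τ₀, hτ₁, hτ₂⟩ := (h1.and h2).exists
  -- the values at `τ₀` are distinct roots of a nonzero polynomial of degree `≤ n`
  set b : Fin (n + 1) → ℂ := fun j ↦ (Q j).eval (kleinJ τ₀) with hb
  set P₀ : Polynomial ℂ := ∑ j : Fin (n + 1), Polynomial.C (b j) * Polynomial.X ^ (j : ℕ)
    with hP₀
  have hP0 : P₀ ≠ 0 := sum_C_mul_X_pow_ne_zero (b := b) (k := j₀) hτ₁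
  have hinj : Set.InjOn (fun z : ℍ → ℂ ↦ z τ₀) s := by
    intro z hz z' hz' hzz'
    by_contra hne
    have := hτ₂ (z, z') (Finset.mem_offDiag.mpr ⟨hz, hz', hne⟩)
    exact this (by simpa [sub_eq_zero] using hzz')
  have hroots : s.image (fun z : ℍ → ℂ ↦ z τ₀) ⊆ P₀.roots.toFinset := by
    intro v hv
    obtain ⟨z, hz, rfl⟩ := Finset.mem_image.mp hv
    rw [Multiset.mem_toFinset, Polynomial.mem_roots hP0, Polynomial.IsRoot.def, hP₀,
      eval_sum_C_mul_X_pow]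
    exact (hs z hz).2 τ₀
  calc s.card = (s.image fun z : ℍ → ℂ ↦ z τ₀).card := (Finset.card_image_of_injOn hinj).symm
    _ ≤ P₀.roots.toFinset.card := Finset.card_le_card hroots
    _ ≤ Multiset.card P₀.roots := Multiset.toFinset_card_le _
    _ ≤ P₀.natDegree := Polynomial.card_roots' _
    _ ≤ n := natDegree_sum_C_mul_X_pow_le b

/-- **Finiteness of the holomorphic roots** of `Σⱼ Q_j(j(τ)) Zʲ` (`Q` with a nonzero entry). -/
private theorem finite_roots {n : ℕ} (Q : Fin (n + 1) → Polynomial ℂ) (j₀ : Fin (n + 1))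
    (hQ : Q j₀ ≠ 0) :
    {z : ℍ → ℂ | MDiff z ∧ ∀ τ : ℍ, ∑ j, (Q j).eval (kleinJ τ) * z τ ^ (j : ℕ) = 0}.Finite := by
  by_contra hinf
  obtain ⟨t, ht, hcard⟩ := Set.Infinite.exists_subset_card_eq hinf (n + 1)
  have := card_le_of_roots Q j₀ hQ t fun z hz ↦ ht hz
  omega

/-! ## Growth at `i∞` -/

/-- `‖j(τ)‖ → ∞` as `Im τ → ∞`: indeed `q j → 1`, so `‖j(τ)‖ ≥ ½ e^{2π Im τ}` high up. -/
private theorem tendsto_norm_kleinJ_atImInfty :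
    Filter.Tendsto (fun τ : ℍ ↦ ‖kleinJ τ‖) atImInfty Filter.atTop := by
  -- `q j → 1`
  have hqJ : Filter.Tendsto (fun τ : ℍ ↦ Function.Periodic.qParam 1 τ * kleinJ τ)
      atImInfty (𝓝 1) := by
    have hE : Filter.Tendsto (fun τ : ℍ ↦ ModularForm.E₄ τ ^ 3) atImInfty (𝓝 1) := by
      simpa using (ModularForm.tendsto_E_atImInfty (k := 4) (by norm_num) ⟨2, rfl⟩).pow 3
    have h := hE.div ModularForm.tendsto_atImInfty_tprod_one_sub_eta_q_pow one_ne_zero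
    rw [div_one] at h
    exact h.congr fun τ ↦ (qParam_mul_kleinJ_eq τ).symm
  have hev : ∀ᶠ τ : ℍ in atImInfty, 1 / 2 ≤ ‖Function.Periodic.qParam 1 τ * kleinJ τ‖ := by
    have := hqJ.norm
    rw [norm_one] at this
    exact this.eventually (eventually_ge_nhds (by norm_num : (1 / 2 : ℝ) < 1))
  have him : Filter.Tendsto (fun τ : ℍ ↦ τ.im) atImInfty Filter.atTop := Filter.tendsto_comap
  have hexp : Filter.Tendsto (fun τ : ℍ ↦ 1 / 2 * Real.exp (2 * Real.pi * τ.im))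
      atImInfty Filter.atTop :=
    (Real.tendsto_exp_atTop.comp (him.const_mul_atTop (by positivity))).const_mul_atTop
      (by norm_num)
  refine Filter.tendsto_atTop_mono' _ ?_ hexp
  filter_upwards [hev] with τ hτ
  rw [norm_mul, Function.Periodic.norm_qParam] at hτ
  simp only [UpperHalfPlane.coe_im, div_one] at hτ
  have hprod : Real.exp (-2 * Real.pi * τ.im) * Real.exp (2 * Real.pi * τ.im) = 1 := by
    rw [← Real.exp_add]
    norm_num
  calc 1 / 2 * Real.exp (2 * Real.pi * τ.im)
      ≤ Real.exp (-2 * Real.pi * τ.im) * ‖kleinJ τ‖ * Real.exp (2 * Real.pi * τ.im) := by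
        gcongr
    _ = ‖kleinJ τ‖ := by rw [mul_right_comm, hprod, one_mul]

/-- **Uniform exponential growth of the roots at `i∞`.** If `Q : Fin (n + 1) → ℂ[X]` has a
nonzero entry, there are `A, K, T₀` such that every solution `z` of `Σⱼ Q_j(j(τ)) z(τ)ʲ = 0` on
`ℍ` satisfies `‖z(τ)‖ ≤ K e^{A Im τ}` for `Im τ ≥ T₀` (Cauchy's root bound for the top
nonvanishing `Q_e`, `‖j(τ)‖ ≤ C e^{2π Im τ}`, and `‖Q_e(j(τ))‖ ≥ m > 0` near `i∞`). -/
private theorem growth_of_roots {n : ℕ} (Q : Fin (n + 1) → Polynomial ℂ) (j₀ : Fin (n + 1))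
    (hQ : Q j₀ ≠ 0) :
    ∃ A K T₀ : ℝ, ∀ z : ℍ → ℂ, (∀ τ : ℍ, ∑ j, (Q j).eval (kleinJ τ) * z τ ^ (j : ℕ) = 0) →
      ∀ τ : ℍ, T₀ ≤ τ.im → ‖z τ‖ ≤ K * Real.exp (A * τ.im) := by
  classical
  -- the top nonvanishing index `e`
  obtain ⟨e, he, habove⟩ : ∃ e : Fin (n + 1), Q e ≠ 0 ∧ ∀ j, e < j → Q j = 0 := by
    set S : Finset (Fin (n + 1)) := Finset.univ.filter fun j ↦ Q j ≠ 0 with hS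
    have hSne : S.Nonempty := ⟨j₀, by simp [hS, hQ]⟩
    refine ⟨S.max' hSne, ?_, fun j hj ↦ ?_⟩
    · have := S.max'_mem hSne
      simp only [hS, Finset.mem_filter, Finset.mem_univ, true_and] at this
      exact this
    · by_contra hne
      exact absurd (S.le_max' j (by simp [hS, hne])) (not_le.mpr hj)
  -- growth of `j` from above, and a lower bound for `Q_e ∘ j` near `i∞`
  obtain ⟨C₁, A₁, hC₁, -, hJle⟩ := exists_norm_kleinJ_le
  obtain ⟨m, hm, A₂, hQe⟩ : ∃ m : ℝ, 0 < m ∧ ∃ A₂ : ℝ, ∀ τ : ℍ, A₂ ≤ τ.im →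
      m ≤ ‖(Q e).eval (kleinJ τ)‖ := by
    by_cases hdeg : 0 < (Q e).degree
    · have ht := (Polynomial.tendsto_norm_atTop (Q e) hdeg
        tendsto_norm_kleinJ_atImInfty).eventually_ge_atTop 1
      obtain ⟨A₂, hA₂⟩ := (UpperHalfPlane.atImInfty_mem _).mp ht
      exact ⟨1, one_pos, A₂, fun τ hτ ↦ hA₂ τ hτ⟩
    · set a : ℂ := (Q e).coeff 0 with ha
      have hC : Q e = Polynomial.C a := Polynomial.eq_C_of_degree_le_zero (not_lt.mp hdeg)
      have ha0 : a ≠ 0 := fun h ↦ he (by rw [hC, h, map_zero])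
      exact ⟨‖a‖, norm_pos_iff.mpr ha0, 0, fun τ _ ↦ by rw [hC, Polynomial.eval_C]⟩
  -- constants
  set D : ℕ := Finset.univ.sup fun j ↦ (Q j).natDegree with hD
  set B : ℝ := ∑ j : Fin (n + 1), ∑ i ∈ Finset.range ((Q j).natDegree + 1), ‖(Q j).coeff i‖
    with hB
  have hB0 : 0 ≤ B :=
    Finset.sum_nonneg fun _ _ ↦ Finset.sum_nonneg fun _ _ ↦ norm_nonneg _
  refine ⟨2 * Real.pi * D, 1 + B * C₁ ^ D / m, max A₁ A₂, fun z hz τ hτ ↦ ?_⟩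
  have hA₁ : A₁ ≤ τ.im := (le_max_left _ _).trans hτ
  have hA₂ : A₂ ≤ τ.im := (le_max_right _ _).trans hτ
  have him0 : 0 ≤ τ.im := τ.im_pos.le
  -- `M = C₁ e^{2π Im τ} ≥ 1` bounds `‖j(τ)‖`
  set M : ℝ := C₁ * Real.exp (2 * Real.pi * τ.im) with hM
  have hE1 : 1 ≤ Real.exp (2 * Real.pi * τ.im) := Real.one_le_exp (by positivity)
  have hM1 : 1 ≤ M := by nlinarith
  have hJM : ‖kleinJ τ‖ ≤ M := hJle τ hA₁
  -- the coefficients at `τ`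
  set b : Fin (n + 1) → ℂ := fun j ↦ (Q j).eval (kleinJ τ) with hb
  have hb_le : ∀ j, ‖b j‖ ≤
      (∑ i ∈ Finset.range ((Q j).natDegree + 1), ‖(Q j).coeff i‖) * M ^ D := by
    intro j
    show ‖(Q j).eval (kleinJ τ)‖ ≤ _
    rw [Polynomial.eval_eq_sum_range, Finset.sum_mul]
    refine (norm_sum_le _ _).trans (Finset.sum_le_sum fun i hi ↦ ?_)
    rw [norm_mul, norm_pow]
    have hi' : i ≤ D := (Nat.lt_succ_iff.mp (Finset.mem_range.mp hi)).trans
      (Finset.le_sup (f := fun j ↦ (Q j).natDegree) (Finset.mem_univ j))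
    exact mul_le_mul_of_nonneg_left
      ((pow_le_pow_left₀ (norm_nonneg _) hJM i).trans (pow_le_pow_right₀ hM1 hi'))
      (norm_nonneg _)
  have hsum_le : ∑ j, ‖b j‖ ≤ B * M ^ D := by
    rw [hB, Finset.sum_mul]
    exact Finset.sum_le_sum fun j _ ↦ hb_le j
  have hbe : m ≤ ‖b e‖ := hQe τ hA₂
  have hbe0 : b e ≠ 0 := norm_pos_iff.mp (hm.trans_le hbe)
  have hroot := norm_root_le b e hbe0 (fun j hj ↦ by simp [hb, habove j hj]) (hz τ)
  have hMD : M ^ D = C₁ ^ D * Real.exp (2 * Real.pi * D * τ.im) := by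
    rw [hM, mul_pow, ← Real.exp_nat_mul]
    ring_nf
  have hED : 1 ≤ Real.exp (2 * Real.pi * D * τ.im) := Real.one_le_exp (by positivity)
  have hquot : 0 ≤ (∑ j, ‖b j‖) / ‖b e‖ :=
    div_nonneg (Finset.sum_nonneg fun _ _ ↦ norm_nonneg _) (norm_nonneg _)
  have hBC : 0 ≤ B * C₁ ^ D / m := by positivity
  calc ‖z τ‖ ≤ max 1 ((∑ j, ‖b j‖) / ‖b e‖) := hroot
    _ ≤ 1 + (∑ j, ‖b j‖) / ‖b e‖ := max_le (by linarith) (by linarith)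
    _ ≤ 1 + B * M ^ D / m := by
      have := div_le_div₀ (by positivity) hsum_le hm hbe
      linarith
    _ = 1 + B * C₁ ^ D / m * Real.exp (2 * Real.pi * D * τ.im) := by rw [hMD]; ring
    _ ≤ (1 + B * C₁ ^ D / m) * Real.exp (2 * Real.pi * D * τ.im) := by nlinarith

/-! ## The stub -/

/-- **Monodromy.** A holomorphic `1`-periodic function `y` on `ℍ` that satisfies a non-trivial
polynomial relation `Σ c_{ij} j(τ)ⁱ y(τ)ʲ = 0` with Klein's `j` is invariant under a finite-index
subgroup `Γ' ∋ T` of `SL₂(ℤ)`, and all its translates `y ∘ γ` grow at most exponentially in `Im τ`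
(uniformly in `γ ∈ SL₂(ℤ)`): the holomorphic roots of the relation are finitely many, permuted by
`SL₂(ℤ)`, and bounded by Cauchy's root bound in terms of `|j| ≍ e^{2π Im τ}`. -/
theorem stub_monodromy (y : ℍ → ℂ) (hy : MDifferentiable 𝓘(ℂ, ℂ) 𝓘(ℂ, ℂ) y)
    (hper : ∀ τ : ℍ, y ((1 : ℝ) +ᵥ τ) = y τ)
    (D₁ D₂ : ℕ) (c : Fin (D₁ + 1) → Fin (D₂ + 1) → ℂ) (hc : c ≠ 0)
    (hrel : ∀ τ : ℍ, ∑ i : Fin (D₁ + 1), ∑ j : Fin (D₂ + 1),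
      c i j * kleinJ τ ^ (i : ℕ) * y τ ^ (j : ℕ) = 0) :
    ∃ Γ' : Subgroup SL(2, ℤ), Γ'.FiniteIndex ∧ ModularGroup.T ∈ Γ' ∧
      (∀ γ ∈ Γ', ∀ τ : ℍ, y (γ • τ) = y τ) ∧
      ∃ A K T₀ : ℝ, ∀ (γ : SL(2, ℤ)) (τ : ℍ), T₀ ≤ τ.im → ‖y (γ • τ)‖ ≤ K * Real.exp (A * τ.im) := by
  classical
  -- the relation as a polynomial in `y` with coefficients in `ℂ[j]`
  set Q : Fin (D₂ + 1) → Polynomial ℂ :=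
    fun j ↦ ∑ i : Fin (D₁ + 1), Polynomial.C (c i j) * Polynomial.X ^ (i : ℕ) with hQdef
  have hconv : ∀ (z : ℍ → ℂ) (τ : ℍ),
      ∑ i : Fin (D₁ + 1), ∑ j : Fin (D₂ + 1), c i j * kleinJ τ ^ (i : ℕ) * z τ ^ (j : ℕ) =
        ∑ j, (Q j).eval (kleinJ τ) * z τ ^ (j : ℕ) := by
    intro z τ
    rw [Finset.sum_comm]
    simp only [hQdef, eval_sum_C_mul_X_pow, Finset.sum_mul]
  obtain ⟨i₀, j₀, hij⟩ : ∃ i j, c i j ≠ 0 := by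
    by_contra! h
    exact hc (funext fun i ↦ funext fun j ↦ h i j)
  have hQ : Q j₀ ≠ 0 := sum_C_mul_X_pow_ne_zero (b := fun i ↦ c i j₀) (k := i₀) hij
  -- the finite set of holomorphic roots, stable under `SL(2, ℤ)`
  set R : Set (ℍ → ℂ) :=
    {z | MDiff z ∧ ∀ τ : ℍ, ∑ j, (Q j).eval (kleinJ τ) * z τ ^ (j : ℕ) = 0} with hR
  have hyR : y ∈ R := ⟨hy, fun τ ↦ by rw [← hconv]; exact hrel τ⟩
  have hsmulR : ∀ z ∈ R, ∀ γ : SL(2, ℤ), (fun τ ↦ z (γ • τ)) ∈ R := fun z hz γ ↦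
    ⟨ModularLambda.mdifferentiable_comp_smul hz.1 γ, fun τ ↦ by
      simpa only [kleinJ_smul] using hz.2 (γ • τ)⟩
  haveI : Finite R := (finite_roots Q j₀ hQ).to_subtype
  -- the stabiliser of `y`
  let Γ' : Subgroup SL(2, ℤ) :=
    { carrier := {γ | ∀ τ : ℍ, y (γ • τ) = y τ}
      mul_mem' := fun {a b} ha hb τ ↦ by
        show y ((a * b) • τ) = y τ
        rw [mul_smul, ha, hb]
      one_mem' := fun τ ↦ by
        show y ((1 : SL(2, ℤ)) • τ) = y τ
        rw [one_smul]
      inv_mem' := fun {a} ha τ ↦ by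
        show y (a⁻¹ • τ) = y τ
        simpa using (ha (a⁻¹ • τ)).symm }
  have hmem : ∀ γ : SL(2, ℤ), γ ∈ Γ' ↔ ∀ τ : ℍ, y (γ • τ) = y τ := fun γ ↦ Iff.rfl
  refine ⟨Γ', ?_, ?_, fun γ hγ ↦ (hmem γ).mp hγ, ?_⟩
  · -- finite index: `γ ↦ y ∘ γ⁻¹` injects `SL(2, ℤ) ⧸ Γ'` into the finite set `R`
    let ψ : SL(2, ℤ) → R := fun γ ↦ ⟨fun τ ↦ y (γ⁻¹ • τ), hsmulR y hyR γ⁻¹⟩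
    have hψv : ∀ (γ : SL(2, ℤ)) (τ : ℍ), (ψ γ : ℍ → ℂ) τ = y (γ⁻¹ • τ) := fun _ _ ↦ rfl
    have hψ : ∀ a b : SL(2, ℤ), ψ a = ψ b ↔ a⁻¹ * b ∈ Γ' := by
      intro a b
      rw [hmem]
      constructor
      · intro h τ
        have := congrFun (congrArg Subtype.val h) (b • τ)
        rw [hψv, hψv] at this
        simpa [mul_smul] using this
      · intro h
        apply Subtype.ext
        funext τ
        rw [hψv, hψv]
        simpa [mul_smul] using h (b⁻¹ • τ)
    let φ : SL(2, ℤ) ⧸ Γ' → R :=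
      Quotient.lift ψ fun a b hab ↦ (hψ a b).mpr (QuotientGroup.leftRel_apply.mp hab)
    have hφ : Function.Injective φ := by
      intro p q h
      obtain ⟨a, rfl⟩ := QuotientGroup.mk_surjective p
      obtain ⟨b, rfl⟩ := QuotientGroup.mk_surjective q
      exact QuotientGroup.eq.mpr ((hψ a b).mp h)
    haveI : Finite (SL(2, ℤ) ⧸ Γ') := Finite.of_injective φ hφ
    exact Subgroup.finiteIndex_of_finite_quotient
  · -- `T ∈ Γ'` by periodicity
    rw [hmem]
    intro τ
    rw [UpperHalfPlane.modular_T_smul]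
    exact hper τ
  · -- growth of all translates
    obtain ⟨A, K, T₀, h⟩ := growth_of_roots Q j₀ hQ
    exact ⟨A, K, T₀, fun γ τ hτ ↦ h (fun τ ↦ y (γ • τ)) (hsmulR y hyR γ).2 τ hτ⟩

end Summit.Langlands.Langlands.Theorems.CapacityClassicality

end
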